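import Summits.KontsevichZagierPeriods.KontsevichZagierPeriods.Theses.FurushoPentagon
import Literature.NumberTheory.Transcendental.KZProductIdeal
import Literature.NumberTheory.Transcendental.KZUnfolding
import Literature.NumberTheory.Transcendental.KZLogCalculusProofs
import Literature.NumberTheory.Transcendental.MZVWordShuffle
import Literature.NumberTheory.Transcendental.MZVSimplexRepProofs
import Literature.NumberTheory.Transcendental.SemialgebraicMapsProofs

/-!
# `HoffmanRelationInKZ`, line `dilation-homotopy-transposition`: the peak exists

Stub `stub_peakExists` of the crux `HoffmanRelationInKZ` (stmt-KontsevichZagierPeriods-3930, route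
FurushoPentagon).  For a non-empty admissible `s` of weight `n`, with the cubical integrand `f = f_s`,
the dilation kernel `K = K_s = ∂_μ(μ f_s(μ x₀, x'))` and the shear `σ c x = (c x₀, x₁, …)` entering
through defining hypotheses, and GRANTED the dilation calculus (derivative, continuity, sign and
`ℚ`-semialgebraicity clauses) and the existence of the stuffle side
`B_s = [(0,1)ⁿ⁺¹, (f(x) − u f(σ u x))/(1 − u)]`, the PEAK

`P_s = [{(u, x, λ) ∈ (0,1)ⁿ⁺² | u < λ}, K(σ λ x)/(1 − u)]`

is an integral representation in the sense of Kontsevich–Zagier (`KZ.IntegralRep (n + 2)`):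

* the domain is cut out by strict polynomial inequalities, hence `ℚ`-semialgebraic;
* the integrand is `ℚ`-semialgebraic on the bigger band `{(u, x) ∈ (0,1)ⁿ⁺¹, 0 ≤ λ ≤ 1}` by
  hypothesis, hence on the domain;
* ABSOLUTE INTEGRABILITY is Tonelli along the last coordinate `λ`
  (`KZlog.integrableOn_band_of_lintegral_fibre_le`): the kernel is `≥ 0`, and on the fibre over
  `(u, x)` the fundamental theorem of calculus gives
  `∫_u^1 K(σ λ x) dλ = 1·f(σ 1 x) − u·f(σ u x) = f(x) − u f(σ u x)`, so the fibre integral of the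
  peak integrand is exactly the (integrable) stuffle-side integrand `B_s(u, x)`.

References: M. Kontsevich, D. Zagier, *Periods* (2001), §1.1–1.2; K. Ihara, M. Kaneko, D. Zagier,
*Derivation and double shuffle relations for multiple zeta values* (2006), Thm. 2.
-/

noncomputable section

open Set MeasureTheory
open Literature.NumberTheory.Transcendental
open Literature.ModelTheory.ExponentialFields (IsSemialgebraic)

namespace Summit.KontsevichZagierPeriods.FurushoPentagon.HoffmanRelationInKZ

/-- The open unit cube `(0,1)ᵐ ⊆ ℝᵐ` is `ℚ`-semialgebraic (finitely many strict polynomial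
inequalities `0 < xⱼ`, `0 < 1 − xⱼ`). [folklore] -/
theorem peak_isSemialgebraic_cube (m : ℕ) :
    IsSemialgebraic ℚ {x : Fin m → ℝ | ∀ i, x i ∈ Set.Ioo (0:ℝ) 1} := by
  have h : {x : Fin m → ℝ | ∀ i, x i ∈ Set.Ioo (0:ℝ) 1} =
      ⋂ j ∈ (Finset.univ : Finset (Fin m)),
        ({x | 0 < MvPolynomial.aeval x (MvPolynomial.X j : MvPolynomial (Fin m) ℚ)} ∩
          {x | 0 < MvPolynomial.aeval x (1 - MvPolynomial.X j : MvPolynomial (Fin m) ℚ)}) := by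
    ext x
    simp [sub_pos]
  rw [h]
  exact IsSemialgebraic.biInter _ _ fun j _ =>
    (Literature.ModelTheory.ExponentialFields.isSemialgebraic_setOf_eval_pos _).inter
      (Literature.ModelTheory.ExponentialFields.isSemialgebraic_setOf_eval_pos _)

/-- The peak domain `{z ∈ (0,1)ⁿ⁺² | z 0 < z (last)}` is `ℚ`-semialgebraic. [folklore] -/
theorem peak_isSemialgebraic_domain (n : ℕ) :
    IsSemialgebraic ℚ {z : Fin (n + 2) → ℝ | (∀ i, z i ∈ Set.Ioo (0:ℝ) 1) ∧
      z 0 < z (Fin.last (n + 1))} := by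
  have h : {z : Fin (n + 2) → ℝ | (∀ i, z i ∈ Set.Ioo (0:ℝ) 1) ∧ z 0 < z (Fin.last (n + 1))} =
      {z : Fin (n + 2) → ℝ | ∀ i, z i ∈ Set.Ioo (0:ℝ) 1} ∩
        {z | MvPolynomial.aeval z (MvPolynomial.X 0 : MvPolynomial (Fin (n + 2)) ℚ) <
          MvPolynomial.aeval z
            (MvPolynomial.X (Fin.last (n + 1)) : MvPolynomial (Fin (n + 2)) ℚ)} := by
    ext z
    simp
  rw [h]
  exact (peak_isSemialgebraic_cube (n + 2)).inter
    (Literature.ModelTheory.ExponentialFields.isSemialgebraic_setOf_eval_lt _ _)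

/-- **The fibre integral of the peak (FTC).** For `x` in the open cube and `u ∈ (0,1)`:
`∫⁻_{[u,1]} ‖K(σ t x)/(1 − u)‖ dt = ofReal ((f x − u f(σ u x))/(1 − u))`, since the kernel is
non-negative and `t ↦ t f(σ t x)` is a primitive of `t ↦ K(σ t x)` with `σ 1 x = x`. [folklore] -/
theorem peak_lintegral_fibre {n : ℕ} (f K : (Fin n → ℝ) → ℝ)
    (σ : ℝ → (Fin n → ℝ) → (Fin n → ℝ))
    (hσ : ∀ (c : ℝ) (x : Fin n → ℝ) (j : Fin n), σ c x j = if (j : ℕ) = 0 then c * x j else x j)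
    (h1 : ∀ x : Fin n → ℝ, (∀ i, x i ∈ Set.Ioo (0:ℝ) 1) → ∀ l ∈ Set.Ioo (0:ℝ) 1,
      HasDerivAt (fun l : ℝ => l * f (σ l x)) (K (σ l x)) l)
    (h2 : ∀ x : Fin n → ℝ, (∀ i, x i ∈ Set.Ioo (0:ℝ) 1) →
      ContinuousOn (fun l : ℝ => l * f (σ l x)) (Set.Icc 0 1))
    (h3 : ∀ x : Fin n → ℝ, (∀ i, x i ∈ Set.Ioo (0:ℝ) 1) →
      ContinuousOn (fun l : ℝ => K (σ l x)) (Set.Icc 0 1))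
    (h4 : ∀ x : Fin n → ℝ, (∀ i, x i ∈ Set.Ioo (0:ℝ) 1) → ∀ l ∈ Set.Icc (0:ℝ) 1, 0 ≤ K (σ l x))
    {x : Fin n → ℝ} (hx : ∀ i, x i ∈ Set.Ioo (0:ℝ) 1) {u : ℝ} (hu : u ∈ Set.Ioo (0:ℝ) 1) :
    ∫⁻ t in Set.Icc u 1, ‖K (σ t x) / (1 - u)‖ₑ =
      ENNReal.ofReal ((f x - u * f (σ u x)) / (1 - u)) := by
  have hu1 : u ≤ 1 := hu.2.le
  have h1u : 0 < 1 - u := sub_pos.mpr hu.2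
  have hIcc : Set.Icc u 1 ⊆ Set.Icc (0:ℝ) 1 := Set.Icc_subset_Icc_left hu.1.le
  have hnn : ∀ t ∈ Set.Icc u 1, 0 ≤ K (σ t x) / (1 - u) := fun t ht =>
    div_nonneg (h4 x hx t (hIcc ht)) h1u.le
  have hcontK : ContinuousOn (fun t : ℝ => K (σ t x)) (Set.Icc u 1) := (h3 x hx).mono hIcc
  have hcont : ContinuousOn (fun t : ℝ => K (σ t x) / (1 - u)) (Set.Icc u 1) :=
    hcontK.div_const _
  have heq : Set.EqOn (fun t : ℝ => ‖K (σ t x) / (1 - u)‖ₑ)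
      (fun t => ENNReal.ofReal (K (σ t x) / (1 - u))) (Set.Icc u 1) :=
    fun t ht => Real.enorm_eq_ofReal (hnn t ht)
  rw [setLIntegral_congr_fun measurableSet_Icc heq,
    ← ofReal_integral_eq_lintegral_ofReal hcont.integrableOn_Icc
      ((ae_restrict_mem measurableSet_Icc).mono hnn)]
  congr 1
  rw [integral_div, integral_Icc_eq_integral_Ioc, ← intervalIntegral.integral_of_le hu1]
  congr 1
  have hσ1 : σ 1 x = x := by
    funext j
    rw [hσ]
    split_ifs <;> simp
  rw [intervalIntegral.integral_eq_sub_of_hasDerivAt_of_le hu1 ((h2 x hx).mono hIcc)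
    (fun t ht => h1 x hx t ⟨hu.1.trans ht.1, ht.2⟩) (hcontK.intervalIntegrable_of_Icc hu1),
    hσ1, one_mul]

/-- **Tonelli along `λ`.** Granted the dilation calculus and the integrability of the stuffle-side
integrand `(f(x) − u f(σ u x))/(1 − u)` on the open cube `(0,1)ⁿ⁺¹`, the peak integrand
`K(σ λ x)/(1 − u)` (`u = z 0`, `x = tail (init z)`, `λ = z (last)`) is absolutely integrable on the
peak domain `{z ∈ (0,1)ⁿ⁺² | u < λ}`: it is integrable on the closed band
`{init z ∈ (0,1)ⁿ⁺¹, u ≤ λ ≤ 1}` by `KZlog.integrableOn_band_of_lintegral_fibre_le`, the fibre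
integrals being computed by `peak_lintegral_fibre`. [folklore] -/
theorem peak_integrableOn {n : ℕ} (f K : (Fin n → ℝ) → ℝ) (σ : ℝ → (Fin n → ℝ) → (Fin n → ℝ))
    (hσ : ∀ (c : ℝ) (x : Fin n → ℝ) (j : Fin n), σ c x j = if (j : ℕ) = 0 then c * x j else x j)
    (h1 : ∀ x : Fin n → ℝ, (∀ i, x i ∈ Set.Ioo (0:ℝ) 1) → ∀ l ∈ Set.Ioo (0:ℝ) 1,
      HasDerivAt (fun l : ℝ => l * f (σ l x)) (K (σ l x)) l)
    (h2 : ∀ x : Fin n → ℝ, (∀ i, x i ∈ Set.Ioo (0:ℝ) 1) →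
      ContinuousOn (fun l : ℝ => l * f (σ l x)) (Set.Icc 0 1))
    (h3 : ∀ x : Fin n → ℝ, (∀ i, x i ∈ Set.Ioo (0:ℝ) 1) →
      ContinuousOn (fun l : ℝ => K (σ l x)) (Set.Icc 0 1))
    (h4 : ∀ x : Fin n → ℝ, (∀ i, x i ∈ Set.Ioo (0:ℝ) 1) → ∀ l ∈ Set.Icc (0:ℝ) 1, 0 ≤ K (σ l x))
    (h5 : IsSemialgebraicFunOn ℚ {z : Fin (n + 2) → ℝ | (∀ i, Fin.init z i ∈ Set.Ioo (0:ℝ) 1) ∧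
      0 ≤ z (Fin.last (n + 1)) ∧ z (Fin.last (n + 1)) ≤ 1}
      (fun z => K (σ (z (Fin.last (n + 1))) (Fin.tail (Fin.init z))) / (1 - z 0)))
    (hB : IntegrableOn
      (fun y : Fin (n + 1) → ℝ => (f (Fin.tail y) - y 0 * f (σ (y 0) (Fin.tail y))) / (1 - y 0))
      {y : Fin (n + 1) → ℝ | ∀ i, y i ∈ Set.Ioo (0:ℝ) 1}) :
    IntegrableOn (fun z : Fin (n + 2) → ℝ => K (σ (z (Fin.last (n + 1))) (Fin.tail (Fin.init z))) /
        (1 - z 0))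
      {z : Fin (n + 2) → ℝ | (∀ i, z i ∈ Set.Ioo (0:ℝ) 1) ∧ z 0 < z (Fin.last (n + 1))} := by
  set S : Set (Fin (n + 1) → ℝ) := {y | ∀ i, y i ∈ Set.Ioo (0:ℝ) 1} with hS_def
  have hSsa : IsSemialgebraic ℚ S := peak_isSemialgebraic_cube (n + 1)
  have hSm : MeasurableSet S := IsSemialgebraic.measurableSet_holds hSsa
  set Bd : Set (Fin (n + 2) → ℝ) := KZlog.band S (fun y => y 0) (fun _ => 1) with hBd_def
  have hBdsa : IsSemialgebraic ℚ Bd :=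
    KZlog.isSemialgebraic_band (isSemialgebraicFunOn_apply hSsa 0)
      (by simpa using isSemialgebraicFunOn_ratCast hSsa 1)
  have hBdm : MeasurableSet Bd := IsSemialgebraic.measurableSet_holds hBdsa
  have hBdsub : Bd ⊆ {z : Fin (n + 2) → ℝ | (∀ i, Fin.init z i ∈ Set.Ioo (0:ℝ) 1) ∧
      0 ≤ z (Fin.last (n + 1)) ∧ z (Fin.last (n + 1)) ≤ 1} := by
    intro z hz
    obtain ⟨hzS, hza, hzb⟩ := KZlog.mem_band.1 hz
    exact ⟨hzS, ((hzS 0).1.le.trans hza), hzb⟩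
  have hW : AEStronglyMeasurable (fun z : Fin (n + 2) → ℝ =>
      K (σ (z (Fin.last (n + 1))) (Fin.tail (Fin.init z))) / (1 - z 0)) (volume.restrict Bd) :=
    KZ.aestronglyMeasurable_of_isSemialgebraicFunOn (h5.mono hBdsub hBdsa) hBdm
  have hint : IntegrableOn (fun z : Fin (n + 2) → ℝ =>
      K (σ (z (Fin.last (n + 1))) (Fin.tail (Fin.init z))) / (1 - z 0)) Bd := by
    refine KZlog.integrableOn_band_of_lintegral_fibre_le hSm hBdm (fun x t => KZlog.snoc_mem_band)
      hW (fun y hy => ?_) hB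
    have hy0 : y 0 ∈ Set.Ioo (0:ℝ) 1 := hy 0
    have hty : ∀ i, Fin.tail y i ∈ Set.Ioo (0:ℝ) 1 := fun i => hy i.succ
    have hsn : ∀ t : ℝ, K (σ ((Fin.snoc y t : Fin (n + 2) → ℝ) (Fin.last (n + 1)))
        (Fin.tail (Fin.init (Fin.snoc y t : Fin (n + 2) → ℝ)))) /
          (1 - (Fin.snoc y t : Fin (n + 2) → ℝ) 0) = K (σ t (Fin.tail y)) / (1 - y 0) := fun t => by
      simp [Fin.snoc_last, Fin.init_snoc]
    simp_rw [hsn]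
    rw [peak_lintegral_fibre f K σ hσ h1 h2 h3 h4 hty hy0]
    exact Real.ofReal_le_enorm _
  refine hint.mono_set fun z hz => ?_
  obtain ⟨hzI, hzlt⟩ := hz
  exact KZlog.mem_band.2 ⟨fun i => hzI (Fin.castSucc i), hzlt.le, (hzI (Fin.last (n + 1))).2.le⟩

/-- The peak exists, abstract form (any dimension `n`, any `f, K, σ` satisfying the shear formula,
the dilation calculus and the integrability of the stuffle-side integrand on the cube). [folklore] -/
theorem peak_exists_aux {n : ℕ} (f K : (Fin n → ℝ) → ℝ) (σ : ℝ → (Fin n → ℝ) → (Fin n → ℝ))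
    (hσ : ∀ (c : ℝ) (x : Fin n → ℝ) (j : Fin n), σ c x j = if (j : ℕ) = 0 then c * x j else x j)
    (h1 : ∀ x : Fin n → ℝ, (∀ i, x i ∈ Set.Ioo (0:ℝ) 1) → ∀ l ∈ Set.Ioo (0:ℝ) 1,
      HasDerivAt (fun l : ℝ => l * f (σ l x)) (K (σ l x)) l)
    (h2 : ∀ x : Fin n → ℝ, (∀ i, x i ∈ Set.Ioo (0:ℝ) 1) →
      ContinuousOn (fun l : ℝ => l * f (σ l x)) (Set.Icc 0 1))
    (h3 : ∀ x : Fin n → ℝ, (∀ i, x i ∈ Set.Ioo (0:ℝ) 1) →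
      ContinuousOn (fun l : ℝ => K (σ l x)) (Set.Icc 0 1))
    (h4 : ∀ x : Fin n → ℝ, (∀ i, x i ∈ Set.Ioo (0:ℝ) 1) → ∀ l ∈ Set.Icc (0:ℝ) 1, 0 ≤ K (σ l x))
    (h5 : IsSemialgebraicFunOn ℚ {z : Fin (n + 2) → ℝ | (∀ i, Fin.init z i ∈ Set.Ioo (0:ℝ) 1) ∧
      0 ≤ z (Fin.last (n + 1)) ∧ z (Fin.last (n + 1)) ≤ 1}
      (fun z => K (σ (z (Fin.last (n + 1))) (Fin.tail (Fin.init z))) / (1 - z 0)))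
    (hB : IntegrableOn
      (fun y : Fin (n + 1) → ℝ => (f (Fin.tail y) - y 0 * f (σ (y 0) (Fin.tail y))) / (1 - y 0))
      {y : Fin (n + 1) → ℝ | ∀ i, y i ∈ Set.Ioo (0:ℝ) 1}) :
    ∃ R : KZ.IntegralRep (n + 2), (R.domain = {z : Fin (n + 2) → ℝ | (∀ i, z i ∈ Set.Ioo (0:ℝ) 1) ∧
      z 0 < z (Fin.last (n + 1))} ∧ Set.EqOn R.integrand
        (fun z => K (σ (z (Fin.last (n + 1))) (Fin.tail (Fin.init z))) / (1 - z 0)) R.domain) := by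
  have hdom := peak_isSemialgebraic_domain n
  refine ⟨⟨{z : Fin (n + 2) → ℝ | (∀ i, z i ∈ Set.Ioo (0:ℝ) 1) ∧ z 0 < z (Fin.last (n + 1))},
    fun z => K (σ (z (Fin.last (n + 1))) (Fin.tail (Fin.init z))) / (1 - z 0), hdom,
    h5.mono (fun z hz => ?_) hdom, peak_integrableOn f K σ hσ h1 h2 h3 h4 h5 hB⟩, rfl,
    fun _ _ => rfl⟩
  exact ⟨fun i => hz.1 (Fin.castSucc i), (hz.1 _).1.le, (hz.1 _).2.le⟩

/-- STUB `stub_peakExists` (the peak exists).  For a non-empty admissible `s`, granted the dilation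
calculus and the existence of the stuffle side `B_s`: the peak
`[{(u,x,λ) ∈ (0,1)ⁿ⁺² | u < λ}, K_s(λx₀,x')/(1−u)]` is an integral representation — semialgebraic
domain and integrand, and ABSOLUTELY INTEGRABLE by Tonelli along `λ`: the kernel is `≥ 0` and
`∫_u^1 K_s(λx₀,x') dλ = f_s(x) − u f_s(ux₀,x')` (FTC), so `∫ peak = ∫ B_s < ∞`
(`peak_exists_aux`, the only use of `B_s` being the integrability of its integrand on the cube).
[folklore] -/
theorem stub_peakExists : ∀ (s : List ℕ), MZV.IsAdmissible s → s ≠ [] → ∀ (f : (Fin (MZV.weight s) → ℝ) → ℝ) (K : (Fin (MZV.weight s) → ℝ) → ℝ) (σ : ℝ → (Fin (MZV.weight s) → ℝ) → (Fin (MZV.weight s) → ℝ)), (∀ (c : ℝ) (x : Fin (MZV.weight s) → ℝ) (j : Fin (MZV.weight s)), σ c x j = if (j : ℕ) = 0 then c * x j else x j) → ((∀ x : Fin (MZV.weight s) → ℝ, (∀ i, x i ∈ Set.Ioo (0:ℝ) 1) → ∀ l ∈ Set.Ioo (0:ℝ) 1, HasDerivAt (fun l : ℝ => l * f (σ l x))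 (K (σ l x)) l) ∧ (∀ x : Fin (MZV.weight s) → ℝ, (∀ i, x i ∈ Set.Ioo (0:ℝ) 1) → ContinuousOn (fun l : ℝ => l * f (σ l x)) (Set.Icc 0 1)) ∧ (∀ x : Fin (MZV.weight s) → ℝ, (∀ i, x i ∈ Set.Ioo (0:ℝ) 1) → ContinuousOn (fun l : ℝ => K (σ l x)) (Set.Icc 0 1)) ∧ (∀ x : Fin (MZV.weight s) → ℝ, (∀ i, x i ∈ Set.Ioo (0:ℝ) 1) → ∀ l ∈ Set.Icc (0:ℝ) 1, 0 ≤ K (σ l x)) ∧ IsSemialgebraicFunOn ℚ {z : Fin (MZV.weight s + 2) → ℝ | (∀ i, Fin.init z i ∈ Set.Ioo (0:ℝ) 1) ∧ 0 ≤ z (Fin.last (MZV.weight s + 1)) ∧ z (Fin.last (MZV.weight s + 1)) ≤ 1} (fun z => K (σ (z (Fin.last (MZV.weight s + 1))) (Fin.tail (Fin.init z))) / (1 - z 0)) ∧ IsSemialgebraicFunOn ℚ {z : Fin (MZV.weight s + 2) → ℝ | (∀ i, Fin.init z i ∈ Set.Ioo (0:ℝ) 1) ∧ 0 ≤ z (Fin.last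 (MZV.weight s + 1)) ∧ z (Fin.last (MZV.weight s + 1)) ≤ 1} (fun z => z (Fin.last (MZV.weight s + 1)) * f (σ (z (Fin.last (MZV.weight s + 1))) (Fin.tail (Fin.init z))) / (1 - z 0))) → (∃ r : KZ.IntegralRep (MZV.weight s + 1), (r.domain = {y : Fin (MZV.weight s + 1) → ℝ | ∀ i, y i ∈ Set.Ioo (0:ℝ) 1} ∧ Set.EqOn r.integrand (fun y => (f (Fin.tail y) - y 0 * f (σ (y 0) (Fin.tail y))) / (1 - y 0)) r.domain)) → ∃ R : KZ.IntegralRep (MZV.weight s + 2), (R.domain = {z : Fin (MZV.weight s + 2) → ℝ | (∀ i, z i ∈ Set.Ioo (0:ℝ) 1) ∧ z 0 < z (Fin.last (MZV.weight s + 1))} ∧ Set.EqOn R.integrand (fun z => K (σ (z (Fin.last (MZV.weight s + 1))) (Fin.tail (Fin.init z))) / (1 - z 0)) R.domain) := by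
  intro s _ _ f K σ hσ hcalc hB
  obtain ⟨h1, h2, h3, h4, h5, -⟩ := hcalc
  obtain ⟨rB, hrBdom, hrBint⟩ := hB
  have hSm : MeasurableSet {y : Fin (MZV.weight s + 1) → ℝ | ∀ i, y i ∈ Set.Ioo (0:ℝ) 1} :=
    IsSemialgebraic.measurableSet_holds (peak_isSemialgebraic_cube (MZV.weight s + 1))
  have hBint : IntegrableOn (fun y : Fin (MZV.weight s + 1) → ℝ =>
      (f (Fin.tail y) - y 0 * f (σ (y 0) (Fin.tail y))) / (1 - y 0))
      {y : Fin (MZV.weight s + 1) → ℝ | ∀ i, y i ∈ Set.Ioo (0:ℝ) 1} := by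
    have h := rB.integrableOn
    rw [hrBdom] at h hrBint
    exact h.congr_fun hrBint hSm
  exact peak_exists_aux f K σ hσ h1 h2 h3 h4 h5 hBint

end Summit.KontsevichZagierPeriods.FurushoPentagon.HoffmanRelationInKZ
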